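import Summits.CriticalPhenomena.PercolationContinuityZ3.Theses.PercTorusSliceFilling
import HarnessLib

/-!
# Crux `PercTorusSliceFilling.NoCriticalTorusGiant` (stmt-CriticalPhenomena-5407), line `registered` (`birth`) — stub `stub_sfGiantSecondMoment` (S2a)

Helper file for the crux skeleton `Cruxes/NoCriticalTorusGiant/Lines/birth.lean`. Proves exactly
the registered stub signature `stub_sfGiantSecondMoment`; lands with
`--supports stmt-CriticalPhenomena-5407`.

## The statement (quadratic Markov, sum form)

On the discrete torus `T_n = (ℤ/nℤ)³` (`torusGraph 3 n`, `n ≥ 1`) with Bernoulli bond percolation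
`P = P_{T_n,p}`, call the open cluster `C(x) = openCluster ω x` slice-filling, `sf_x`, if
`∃ i, ∀ t : ZMod n, ∃ y ∈ C(x), y i = t`, and put `f_x = 1{sf_x} · |C(x)|`. For `k ≥ 1`,
`P(∃ x, k ≤ |C(x)| ∧ sf_x) ≤ k⁻² · Σ_x E[f_x]`.

## The argument

Pointwise `k² · 1{∃ x, k ≤ |C(x)| ∧ sf_x} ≤ Σ_x f_x`: on the event pick `x₀` with `k ≤ |C(x₀)|`
and `sf_{x₀}`; every `y ∈ C(x₀)` has `C(y) = C(x₀)`, hence `sf_y` and `f_y = |C(x₀)| ≥ k`; there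
are `|C(x₀)| ≥ k` such `y`, and all `f_x ≥ 0`. Integrate over the finite configuration space
(every set is measurable, every function integrable) and divide by `k² > 0`.
-/

noncomputable section

namespace Summit.CriticalPhenomena.PercolationContinuityZ3.Theorems.PercTorusSliceFillingNoCriticalTorusGiant

open MeasureTheory ProbabilityTheory
open Literature.Probability.Percolation Literature.Probability.LatticeModels

namespace S2a

variable {V : Type*}

/-- If `y ∈ C(x₀)` then `C(y) = C(x₀)` (open reachability is an equivalence relation).
[folklore] -/
theorem openCluster_eq_of_mem (ω : BondConfig V) {x₀ y : V} (h : y ∈ openCluster ω x₀) :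
    openCluster ω y = openCluster ω x₀ := by
  ext z
  simp only [openCluster, Set.mem_setOf_eq] at h ⊢
  exact ⟨fun hyz => h.trans hyz, fun hxz => h.symm.trans hxz⟩

/-- **Pointwise quadratic counting.** On a finite vertex type, for a property `Q` of vertex sets,
a vertex `x₀` with `k ≤ |C(x₀)|` and `Q (C x₀)` forces `k² ≤ Σ_x 1{Q (C x)} · |C x|`: each of
the `≥ k` members `y` of `C(x₀)` has `C(y) = C(x₀)`, so it contributes `|C(x₀)| ≥ k`, and every
term is non-negative. [folklore] -/
theorem sq_le_sum_indicator_ncard [Fintype V] (ω : BondConfig V) (Q : Set V → Prop) (k : ℕ)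
    (x₀ : V) (hk : k ≤ (openCluster ω x₀).ncard) (hQ : Q (openCluster ω x₀)) :
    (k : ℝ) ^ 2 ≤ ∑ x : V, {ω' : BondConfig V | Q (openCluster ω' x)}.indicator
      (fun ω' => ((openCluster ω' x).ncard : ℝ)) ω := by
  classical
  set C := openCluster ω x₀ with hC
  have hCfin : C.Finite := Set.toFinite C
  have hterm : ∀ y ∈ hCfin.toFinset, {ω' : BondConfig V | Q (openCluster ω' y)}.indicator
      (fun ω' => ((openCluster ω' y).ncard : ℝ)) ω = (C.ncard : ℝ) := by
    intro y hy
    have hyC : openCluster ω y = C := openCluster_eq_of_mem ω ((Set.Finite.mem_toFinset _).1 hy)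
    have hmem : ω ∈ {ω' : BondConfig V | Q (openCluster ω' y)} := by
      rw [Set.mem_setOf_eq, hyC]
      exact hQ
    rw [Set.indicator_of_mem hmem, hyC]
  have hnonneg : ∀ x ∈ (Finset.univ : Finset V), x ∉ hCfin.toFinset →
      0 ≤ {ω' : BondConfig V | Q (openCluster ω' x)}.indicator
        (fun ω' => ((openCluster ω' x).ncard : ℝ)) ω :=
    fun x _ _ => Set.indicator_nonneg (fun _ _ => Nat.cast_nonneg _) ω
  have hcard : (C.ncard : ℝ) = ((hCfin.toFinset.card : ℕ) : ℝ) := by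
    exact_mod_cast Set.ncard_eq_toFinset_card C hCfin
  have hkC : (k : ℝ) ≤ (C.ncard : ℝ) := by exact_mod_cast hk
  calc (k : ℝ) ^ 2 = (k : ℝ) * k := sq _
    _ ≤ (C.ncard : ℝ) * (C.ncard : ℝ) :=
        mul_le_mul hkC hkC (Nat.cast_nonneg _) (Nat.cast_nonneg _)
    _ = ∑ _y ∈ hCfin.toFinset, (C.ncard : ℝ) := by
        rw [Finset.sum_const, nsmul_eq_mul, ← hcard]
    _ = ∑ y ∈ hCfin.toFinset, {ω' : BondConfig V | Q (openCluster ω' y)}.indicator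
          (fun ω' => ((openCluster ω' y).ncard : ℝ)) ω :=
        (Finset.sum_congr rfl hterm).symm
    _ ≤ ∑ x : V, {ω' : BondConfig V | Q (openCluster ω' x)}.indicator
          (fun ω' => ((openCluster ω' x).ncard : ℝ)) ω :=
        Finset.sum_le_sum_of_subset_of_nonneg (Finset.subset_univ _) hnonneg

/-- **Markov's inequality with a constant, sum form.** On a finite measure space, if pointwise
`c · 1_E ≤ Σ_x g x` with `c > 0`, `E` measurable and every `g x` integrable, then
`μ(E) ≤ c⁻¹ · Σ_x ∫ g x` (integrate and use linearity). [folklore] -/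
theorem measureReal_le_inv_mul_sum_integral {Ω ι : Type*} [MeasurableSpace Ω] [Fintype ι]
    (P : Measure Ω) [IsFiniteMeasure P] (E : Set Ω) (hE : MeasurableSet E) (g : ι → Ω → ℝ)
    (hg : ∀ x, Integrable (g x) P) (c : ℝ) (hc : 0 < c)
    (hpt : ∀ ω, c * E.indicator (1 : Ω → ℝ) ω ≤ ∑ x, g x ω) :
    P.real E ≤ c⁻¹ * ∑ x, ∫ ω, g x ω ∂P := by
  rw [le_inv_mul_iff₀ hc]
  calc c * P.real E = ∫ ω, c * E.indicator (1 : Ω → ℝ) ω ∂P := by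
        rw [integral_const_mul, integral_indicator_one hE]
    _ ≤ ∫ ω, ∑ x, g x ω ∂P :=
        integral_mono (((integrable_const (1 : ℝ)).indicator hE).const_mul c)
          (integrable_finsetSum _ fun x _ => hg x) hpt
    _ = ∑ x, ∫ ω, g x ω ∂P := integral_finsetSum _ fun x _ => hg x

end S2a

/-- **Stub S2a `stub_sfGiantSecondMoment` of the line `birth` (crux `NoCriticalTorusGiant`,
stmt-CriticalPhenomena-5407), exactly the registered signature — second moment (quadratic Markov),
sum form.** For `n ≥ 1` and `k ≥ 1`,
`P_{T_n,p}(∃ x, k ≤ |C(x)| ∧ sf_x) ≤ k⁻² · Σ_x E_{T_n,p}[|C(x)| · 1{sf_x}]`: on the event the `≥ k`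
members `y` of the slice-filling `k`-giant `C(x₀)` satisfy `C(y) = C(x₀)`, so each contributes
`|C(y)| · 1{sf_y} = |C(x₀)| ≥ k`, whence `k² · 1_{event} ≤ Σ_x |C(x)| · 1{sf_x}` pointwise
(`S2a.sq_le_sum_indicator_ncard`); integrate over the finite configuration space of `T_n`
(`S2a.measureReal_le_inv_mul_sum_integral`). -/
theorem stub_sfGiantSecondMoment :
    ∀ (p : unitInterval) (n k : ℕ) [NeZero n], 1 ≤ k →
      (bondPercolation (torusGraph 3 n) p).real
          {ω | ∃ x : TorusSite 3 n, k ≤ (openCluster ω x).ncard ∧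
            ∃ i : Fin 3, ∀ t : ZMod n, ∃ y ∈ openCluster ω x, y i = t} ≤
        ((k : ℝ) ^ 2)⁻¹ * ∑ x : TorusSite 3 n,
          ∫ ω, {ω' | ∃ i : Fin 3, ∀ t : ZMod n, ∃ y ∈ openCluster ω' x, y i = t}.indicator
            (fun ω' => ((openCluster ω' x).ncard : ℝ)) ω ∂(bondPercolation (torusGraph 3 n) p) := by
  intro p n k _ hk
  have hk0 : (0 : ℝ) < (k : ℝ) := Nat.cast_pos.mpr hk
  have hk2 : (0 : ℝ) < (k : ℝ) ^ 2 := by positivity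
  refine S2a.measureReal_le_inv_mul_sum_integral (bondPercolation (torusGraph 3 n) p) _
    MeasurableSet.of_discrete
    (fun (x : TorusSite 3 n) (ω' : BondConfig (TorusSite 3 n)) =>
      {ω'' : BondConfig (TorusSite 3 n) |
          ∃ i : Fin 3, ∀ t : ZMod n, ∃ y ∈ openCluster ω'' x, y i = t}.indicator
        (fun ω'' => ((openCluster ω'' x).ncard : ℝ)) ω')
    (fun _ => Integrable.of_finite) _ hk2 fun ω => ?_
  by_cases hω : ω ∈ {ω : BondConfig (TorusSite 3 n) | ∃ x : TorusSite 3 n,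
      k ≤ (openCluster ω x).ncard ∧ ∃ i : Fin 3, ∀ t : ZMod n, ∃ y ∈ openCluster ω x, y i = t}
  · rw [Set.indicator_of_mem hω, Pi.one_apply, mul_one]
    obtain ⟨x₀, hk₀, hsf⟩ := hω
    exact S2a.sq_le_sum_indicator_ncard ω
      (fun S : Set (TorusSite 3 n) => ∃ i : Fin 3, ∀ t : ZMod n, ∃ y ∈ S, y i = t) k x₀ hk₀ hsf
  · rw [Set.indicator_of_notMem hω, mul_zero]
    exact Finset.sum_nonneg fun x _ => Set.indicator_nonneg (fun _ _ => Nat.cast_nonneg _) ω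

end Summit.CriticalPhenomena.PercolationContinuityZ3.Theorems.PercTorusSliceFillingNoCriticalTorusGiant

end
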